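import Literature.MathematicalPhysics.QuantumFieldTheory.Balaban1983to89.Node00.AveragingSmooth
import Literature.MathematicalPhysics.QuantumFieldTheory.Balaban1983to89.Node00.WilsonActionSecondVariation
import Literature.MathematicalPhysics.QuantumFieldTheory.Balaban1983to89.BlockAveragingFederbushGValued
import Literature.MathematicalPhysics.QuantumFieldTheory.Balaban1983to89.B7TransferAnalyticMean

/-!
# NODE 00 — THE CANONICAL LOGARITHMIC CHART OF A MULTI-SCALE CONSTRAINT `Ū^j = W_j on 𝐁`, AND THE TANGENT FORM (82) ON A MULTI-SCALE FIBRE MODULO [15] (45)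
# AT THE CONFIGURATION (a right inverse of the LINEARISED constraint): 35a's `IsFibreChartNear` INSTANTIATED for every level-bounded determining set

Cell `pub-ymgap`, width seat `pub-ymgap-dag-n07-w2` generation 0 (HUMAN RULING D-0149; R141 (C) lane of DAG node N07 = [15] = [Balaban1985Variational]; plan g77 W-SEAT START
LIST v3 §n07 sub-target S2 «[15] Sect. C (47)–(49), Prop. 3 at objects → 35a's `IsFibreChartNear` for the MULTI-SCALE fibre»; INBOX CLAIM l.24097, AUDIT + INTENT-1 l.24275,
audit table `HOME/pub-ymgap-dag-n07-w2/AUDIT-S2-N07W2.md`).  NEW leaf; CONSUMED BY NAME, nothing modified: n07-e's 35a `Node00.CriticalOnFibreTangent` (`expChart`,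
`IsFibreChartNear`, `hasDerivAt_wilsonAction4_expChart_of_isCritOnFibre_near`, `hasDerivAt_ray`), 35b-i `Node00.AveragingSmooth` (`iterM`, `SmallBelow`, `coeField_iter_eq_iterM`,
`contDiffAt_iterM_expChart`, `contDiff_loopM`, `norm_loopM_coeField_sub_one_lt`, `coe_loopHol`), `Node00.WilsonActionSecondVariation` (`star_coe_mul_coe_SU`, `coe_mul_star_coe_SU`), the tree's logarithmic chart of `SU(N)` `BlockAveragingFederbushGValued.specialUnitaryLogChart`
(`mlog_mem`, radius `min(1∕3, 3∕N)`), `MatrixLog` (`exp_mlog`, `analyticAt_mlog`, `mlog_one`) and `B7TransferAnalyticMean.hasFDerivAt_mlog_one` (`D log(1) = id`).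
`--kind definition --supports stmt-QuantumFields-20542` (K1⁷; count-neutral).

WHY.  Stub 1's token `Prop8RegSepTopStep` (K0⁷) states criticality of the Wilson action (5) on the MULTI-SCALE fibre `𝔅(genSet s.Ω k, W)` of [III] (2.2)∕(2.10) in the CURVE form
(`IsCritOnFibre`); Sect. F of [15] uses the TANGENT form (82) on the tangent space (83).  35a reduced «curve ⇒ tangent» to a submersive chart of the constraint (`IsFibreChartNear`:
strictly differentiable at `0`, derivative ONTO, level set near `0` inside the fibre); 35c∕35e discharged it at the ONE-SCALE pin by the route UnitScaleTilt's exact corrector, and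
n07-e's LOCATED-MULTISCALE-FIBRE.md records why central-bond correctors do not decouple a multi-scale fibre at region boundaries, pointing at print's linearizing transformation (47) as the
road.  THIS FILE takes that road in the form the implicit-function theorem actually needs: the CANONICAL chart `Φ(X) = (π(log(W_j(c)*·Ū^j(U·exp X)(c))))_{(j,c)}` over the constrained bonds of
levels `≤ k` (values in `𝔰𝔲(N)`; `π` = the trace-free anti-Hermitian part, the identity on `𝔰𝔲(N)`, where `log` of an `SU(N)` matrix near `1` lands), its strict differentiability at `0`
from 35b-i + the analyticity of `log`, its level set from `e^{log g} = g`, and — the one input print's Sect. C supplies — the SURJECTIVITY of its derivative from a RIGHT INVERSE of the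
LINEARISED multi-scale constraint at `U` ((45) «L^jηQ_jHB = B on Λ_j», here only the existence of some `H`, in the velocity currency of 35c).  With it, curve-critical ⇒ tangent-critical on
EVERY multi-scale fibre (★★★), hence on stub 1's `genSet`.  The nonlinear fixed point (49)–(50) of (47) (UST `FlatChart47(Levels)`) is NOT needed for the tangent form: Mathlib's
implicit-function theorem (35a §1) replaces print's explicit construction.  SIBLING SOCKET (same day, n07-e INTENT-35i `Thm/BalabanUVNodesN07CritMultiScaleOfCorrector`): the multi-scale (82)
modulo a LOCAL NONLINEAR CORRECTOR `hcorr`; the present socket asks only the LINEAR right inverse (what B6's far-face induction `B6SectAOntoV1.exists_constr` delivers at the flat scalar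
model, and covariant far-face lifts with `Ad`-untwisting deliver at any `U` under [B6] (2.3)'s indexing — successor S2b; see the located index-set junction FINDING A in the audit file:
stub 1's `bondsOf ∘ genSet` (reading (b) of `B15DeterminingSets`) vs [B6] (2.3) `Domains.LamBond`).

CONTENTS.  §1 `suPart`∕`suProj` (the real-linear retraction `M_N(ℂ) → 𝔰𝔲(N)`), `coe_suProj_of_mem`, `suProj_coe`.  §2 `rhoSU`, `mlog_mem_lieSU_of_mem_SU`, `coe_suProj_mlog_of_mem_SU`,
★ `eq_one_of_suProj_mlog_eq_zero` (the level-set step).  §2½ `smallBelow_succ_iff`, ★ `eventually_smallBelow_expChart` (the guard of (0.4) is open along the chart).  §3 `ConstrSet`,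
`constrCard`, `constrEnum`, `relAvg`, ★ `msChart` (the canonical chart), `msChart_zero_of_agreeOn`.  §4 ★ `contDiffAt_msChart`, `hasStrictFDerivAt_msChart`, ★★ `fderiv_msChart_apply_of_hasDerivAt`
(`(Φ′X)_{(j,c)} = π(W_j(c)*·v)` for the velocity `v` of `t ↦ Ū^j(U·exp(tX))(c)`).  §5 `eventually_norm_relAvg_sub_one_le`, ★ `eventually_agreeOn_of_msChart_eq`.  §6 ★★ `isFibreChartNear_msChart`,
★★★ `hasDerivAt_wilsonAction4_expChart_of_isCritOnFibre_of_rightInverse`, `…_genSet_of_rightInverse`.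

HONEST FRAMING: kernel calculus on the tree's own averaging and group; three definitions with bodies (`suPart`∕`suProj`, `rhoSU`, the chart `msChart` with its index bookkeeping
`ConstrSet`∕`constrCard`∕`constrEnum`∕`relAvg`), no `Prop`-valued hypothesis object, no estimate of [15]; the right inverse (45) at `U` is a DISPLAYED HYPOTHESIS (`hH`), not constructed
here; stub 1 ∕ K0⁷ NOT closed; N07 NOT discharged; counts unmoved (5∕27); one finite T⁴ programme at fixed ε — NOT continuum ∕ ℝ⁴ ∕ OS ∕ mass gap ∕ Clay (R4 closes the conditional
rung `BalabanLadder.UV` only).  No `sorry`, no `axiom`, no `instance`, no `notation`.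
-/

noncomputable section

namespace Literature.MathematicalPhysics.QuantumFieldTheory.Balaban1983to89.Node00

open Filter Topology
open T4Continuum (T4Family)
open B15DeterminingSets
open BlockAveraging (blockAvg Small Idx loopHol)
open ExpMeanLog (expMeanLogSU deltaSU)
open MatrixLog (mlog mlog_one exp_mlog analyticAt_mlog)
open T4AdjointCovarianceUnitary (lieSU expSU coe_expSU mem_lieSU_iff)
open scoped Matrix.Norms.L2Operator

/-! ## §1  The trace-free anti-Hermitian part `M_N(ℂ) → 𝔰𝔲(N)` (a real-linear retraction onto the Lie algebra) -/

section SuProj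

variable {N : ℕ}

/-- The trace-free anti-Hermitian part of a complex matrix: `π(A) = ½(A − A*) − (tr ½(A − A*) ∕ N)·1` (plumbing for `suProj`). [folklore] -/
def suPart (A : Matrix (Fin N) (Fin N) ℂ) : Matrix (Fin N) (Fin N) ℂ :=
  (2 : ℂ)⁻¹ • (A - star A) - (((2 : ℂ)⁻¹ • (A - star A)).trace / (N : ℂ)) • (1 : Matrix (Fin N) (Fin N) ℂ)

/-- `(½(A − A*))* = −½(A − A*)`. [folklore] -/
private theorem star_half_sub_star (A : Matrix (Fin N) (Fin N) ℂ) :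
    star ((2 : ℂ)⁻¹ • (A - star A)) = -((2 : ℂ)⁻¹ • (A - star A)) := by
  rw [star_smul, star_sub, star_star]
  have h2 : star ((2 : ℂ)⁻¹) = (2 : ℂ)⁻¹ := by simp
  rw [h2, ← smul_neg, neg_sub]

/-- `tr (B*) = (tr B)*`. [folklore] -/
private theorem trace_star_eq (B : Matrix (Fin N) (Fin N) ℂ) : (star B).trace = star B.trace := by
  rw [Matrix.star_eq_conjTranspose, Matrix.trace_conjTranspose]

/-- For an anti-Hermitian `S`, `S − (tr S ∕ N)·1` is anti-Hermitian and trace-free. [folklore] -/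
private theorem sub_trace_smul_one_mem_lieSU {S : Matrix (Fin N) (Fin N) ℂ} (hS : star S = -S) :
    S - (S.trace / (N : ℂ)) • (1 : Matrix (Fin N) (Fin N) ℂ) ∈ lieSU (Fin N) := by
  rw [mem_lieSU_iff]
  have htr : star S.trace = -S.trace := by rw [← trace_star_eq, hS, Matrix.trace_neg]
  have hN : star (N : ℂ) = (N : ℂ) := by simp
  constructor
  · rw [star_sub, star_smul, star_one, hS, star_div₀, htr, hN, neg_div, neg_smul, sub_neg_eq_add, neg_sub', sub_neg_eq_add]
  · rw [Matrix.trace_sub, Matrix.trace_smul, Matrix.trace_one, Fintype.card_fin, smul_eq_mul]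
    rcases Nat.eq_zero_or_pos N with hN0 | hN0
    · subst hN0
      simp [Matrix.trace]
    · rw [div_mul_cancel₀ _ (Nat.cast_ne_zero.2 hN0.ne'), sub_self]

/-- `π(A) ∈ 𝔰𝔲(N)`. [folklore] -/
private theorem suPart_mem (A : Matrix (Fin N) (Fin N) ℂ) : suPart A ∈ lieSU (Fin N) :=
  sub_trace_smul_one_mem_lieSU (star_half_sub_star A)

/-- On `𝔰𝔲(N)` the map `π` is the identity. [folklore] -/
private theorem suPart_of_mem {A : Matrix (Fin N) (Fin N) ℂ} (hA : A ∈ lieSU (Fin N)) : suPart A = A := by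
  obtain ⟨hstar, htr⟩ := mem_lieSU_iff.1 hA
  have hS : (2 : ℂ)⁻¹ • (A - star A) = A := by
    rw [hstar, sub_neg_eq_add, ← two_smul ℂ A, smul_smul, inv_mul_cancel₀ (two_ne_zero), one_smul]
  rw [suPart, hS, htr, zero_div, zero_smul, sub_zero]

/-- `π` is additive. [folklore] -/
private theorem suPart_add (A B : Matrix (Fin N) (Fin N) ℂ) : suPart (A + B) = suPart A + suPart B := by
  simp only [suPart, star_add, smul_sub, smul_add, Matrix.trace_add, Matrix.trace_sub, Matrix.trace_smul, add_div,
    sub_div, add_smul, sub_smul, smul_eq_mul]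
  abel

/-- `π` is real-homogeneous. [folklore] -/
private theorem suPart_smul (r : ℝ) (A : Matrix (Fin N) (Fin N) ℂ) : suPart (r • A) = r • suPart A := by
  have hr : star ((r : ℂ)) = (r : ℂ) := Complex.conj_ofReal r
  have e1 : (r • A : Matrix (Fin N) (Fin N) ℂ) = (r : ℂ) • A := (Complex.coe_smul r A).symm
  rw [e1, suPart, suPart, star_smul, hr, ← smul_sub, smul_comm ((2 : ℂ)⁻¹) (r : ℂ), Matrix.trace_smul, smul_eq_mul,
    mul_div_assoc, ← smul_smul, ← smul_sub, Complex.coe_smul]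

variable (N) in
/-- **The real-linear retraction `M_N(ℂ) → 𝔰𝔲(N)`** (trace-free anti-Hermitian part), as a continuous linear map — the coordinate map of the logarithmic chart of `SU(N)` read in its Lie algebra ((17)–(19): `𝔰𝔲(N)` with its norms inside `M_N(ℂ)`). [cite: Balaban1985Averaging, (17)–(19) p.21 (bookkeeping)] -/
def suProj : Matrix (Fin N) (Fin N) ℂ →L[ℝ] lieSU (Fin N) :=
  LinearMap.toContinuousLinearMap
    { toFun := fun A => ⟨suPart A, suPart_mem A⟩
      map_add' := fun A B => Subtype.ext (suPart_add A B)
      map_smul' := fun r A => Subtype.ext (suPart_smul r A) }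

/-- The matrix of `suProj A` is `suPart A`. [cite: Balaban1985Averaging, (17)–(19) p.21 (bookkeeping: `𝔰𝔲(N) ⊂ M_N(ℂ)`)] -/
@[simp] theorem coe_suProj (A : Matrix (Fin N) (Fin N) ℂ) : ((suProj N A : lieSU (Fin N)) : Matrix (Fin N) (Fin N) ℂ) = suPart A := rfl

/-- `suProj` restricted to `𝔰𝔲(N)` is the identity. [cite: Balaban1985Averaging, (17)–(19) p.21 (bookkeeping: `𝔰𝔲(N) ⊂ M_N(ℂ)`)] -/
theorem suProj_coe (X : lieSU (Fin N)) : suProj N (X : Matrix (Fin N) (Fin N) ℂ) = X :=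
  Subtype.ext (suPart_of_mem X.2)

/-- `suProj A = A` (as matrices) for `A ∈ 𝔰𝔲(N)`. [cite: Balaban1985Averaging, (17)–(19) p.21 (bookkeeping: `𝔰𝔲(N) ⊂ M_N(ℂ)`)] -/
theorem coe_suProj_of_mem {A : Matrix (Fin N) (Fin N) ℂ} (hA : A ∈ lieSU (Fin N)) :
    ((suProj N A : lieSU (Fin N)) : Matrix (Fin N) (Fin N) ℂ) = A := suPart_of_mem hA

end SuProj

/-! ## §2  The logarithm end on `SU(N)`: near `1`, `log g ∈ 𝔰𝔲(N)`, and `π(log g) = 0` forces `g = 1` -/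

section LogEnd

variable {N : ℕ} [NeZero N]

/-- The radius `ρ_N = min(1∕3, 3∕N)` of the tree's logarithmic chart of `SU(N)` (`BlockAveragingFederbushGValued.specialUnitaryLogChart`).
[cite: Balaban1985Averaging, (21) p.21 (the logarithmic series)] -/
def rhoSU (N : ℕ) : ℝ := min (1 / 3) (3 / (N : ℝ))

/-- `0 < ρ_N`. [cite: Balaban1985Averaging, (21) p.21 (bookkeeping: radius of the logarithmic chart)] -/
theorem rhoSU_pos : 0 < rhoSU N :=
  lt_min (by norm_num) (div_pos (by norm_num) (Nat.cast_pos.2 (Nat.pos_of_ne_zero (NeZero.ne N))))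

omit [NeZero N] in
/-- `ρ_N ≤ 1∕3`. [cite: Balaban1985Averaging, (21) p.21 (bookkeeping: radius of the logarithmic chart)] -/
theorem rhoSU_le_third : rhoSU N ≤ 1 / 3 := min_le_left _ _

/-- `ρ_N` IS the radius of the tree's `SU(N)` chart. [cite: Balaban1985Averaging, (21) p.21 (bookkeeping)] -/
theorem rhoSU_eq_chart_ρ : haveI : Nonempty (Fin N) := ⟨⟨0, Nat.pos_of_ne_zero (NeZero.ne N)⟩⟩
    rhoSU N = (specialUnitaryLogChart (Fin N)).ρ := by
  rw [specialUnitaryLogChart_ρ, Fintype.card_fin]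
  rfl

/-- **Near `1`, the logarithm of an `SU(N)` matrix lies in `𝔰𝔲(N)`** (the tree's log chart of `SU(N)`: [Hall2015] Thm 3.42 shape, BY NAME).
[cite: Balaban1985Averaging, (21) p.21] -/
theorem mlog_mem_lieSU_of_mem_SU {g : Matrix (Fin N) (Fin N) ℂ} (hg : g ∈ Matrix.specialUnitaryGroup (Fin N) ℂ)
    (hρ : ‖g - 1‖ ≤ rhoSU N) : mlog g ∈ lieSU (Fin N) := by
  haveI : Nonempty (Fin N) := ⟨⟨0, Nat.pos_of_ne_zero (NeZero.ne N)⟩⟩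
  have hρ' : ‖g - 1‖ ≤ (specialUnitaryLogChart (Fin N)).ρ := by
    rw [specialUnitaryLogChart_ρ, Fintype.card_fin]; exact hρ
  have hmem := (specialUnitaryLogChart (Fin N)).mlog_mem (show g ∈ (specialUnitaryLogChart (Fin N)).carrier from hg) hρ'
  rw [mem_specialUnitaryLogChart_lie] at hmem
  exact mem_lieSU_iff.2 hmem

/-- Near `1` on `SU(N)`: `π(log g) = log g` as matrices. [cite: Balaban1985Averaging, (21) p.21] -/
theorem coe_suProj_mlog_of_mem_SU {g : Matrix (Fin N) (Fin N) ℂ} (hg : g ∈ Matrix.specialUnitaryGroup (Fin N) ℂ)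
    (hρ : ‖g - 1‖ ≤ rhoSU N) : ((suProj N (mlog g) : lieSU (Fin N)) : Matrix (Fin N) (Fin N) ℂ) = mlog g :=
  coe_suProj_of_mem (mlog_mem_lieSU_of_mem_SU hg hρ)

/-- **The level-set step of the canonical chart**: for `g ∈ SU(N)` with `‖g − 1‖ ≤ ρ_N`, `π(log g) = 0 ⇒ g = 1` (`log g ∈ 𝔰𝔲(N)` so `π` does not move it,
and `e^{log g} = g`). [cite: Balaban1985Averaging, (21) p.21 («It is an inverse to the exponential function»)] -/
theorem eq_one_of_suProj_mlog_eq_zero {g : Matrix (Fin N) (Fin N) ℂ} (hg : g ∈ Matrix.specialUnitaryGroup (Fin N) ℂ)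
    (hρ : ‖g - 1‖ ≤ rhoSU N) (h0 : suProj N (mlog g) = 0) : g = 1 := by
  have hlog : mlog g = 0 := by
    rw [← coe_suProj_mlog_of_mem_SU hg hρ, h0, Submodule.coe_zero]
  have h1 : ‖g - 1‖ < 1 := lt_of_le_of_lt hρ (lt_of_le_of_lt rhoSU_le_third (by norm_num))
  rw [← exp_mlog h1, hlog, NormedSpace.exp_zero]

end LogEnd

/-! ## §3  The canonical chart of a multi-scale constraint `Ū^j = W_j` on the bonds of a level-bounded determining set -/

section SUMatrix

variable {N : ℕ}

/-- `W* · V ∈ SU(N)` for `W, V ∈ SU(N)`. [folklore] -/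
private theorem star_coe_mul_coe_mem_SU (W V : SU N) :
    star ((W : SU N) : Matrix (Fin N) (Fin N) ℂ) * (V : Matrix (Fin N) (Fin N) ℂ) ∈ Matrix.specialUnitaryGroup (Fin N) ℂ := by
  obtain ⟨hWu, hWd⟩ := Matrix.mem_specialUnitaryGroup_iff.1 W.2
  obtain ⟨hVu, hVd⟩ := Matrix.mem_specialUnitaryGroup_iff.1 V.2
  refine Matrix.mem_specialUnitaryGroup_iff.2 ⟨?_, ?_⟩
  · exact Submonoid.mul_mem _ (Unitary.star_mem hWu) hVu
  · rw [Matrix.det_mul, Matrix.star_eq_conjTranspose, Matrix.det_conjTranspose, hWd, hVd, star_one, one_mul]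

end SUMatrix

section Guard

variable {P : Params} {N : ℕ} [NeZero N]

/-- `SmallBelow` at `k + 1` is `SmallBelow` at `k` plus the guard at level `k`. [cite: Balaban1987RG1, (0.4) p.253 (bookkeeping)] -/
theorem smallBelow_succ_iff {av : ∀ j, Averaging P j (SU N)} {k : ℕ} {V : GaugeField P 0 (SU N)} :
    SmallBelow av (k + 1) V ↔ SmallBelow av k V ∧ ∀ c : PBond P (k + 1), Small expMeanLogSU (Averaging.iter av k V) c := by
  constructor
  · exact fun h => ⟨h.mono (Nat.le_succ k), fun c => h k (Nat.lt_succ_self k) c⟩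
  · rintro ⟨h, hk⟩ j hj c
    rcases Nat.lt_succ_iff_lt_or_eq.1 hj with hj' | rfl
    · exact h j hj' c
    · exact hk c

/-- ★ **THE GUARD IS OPEN ALONG THE CHART**: if the iterated averages of `U` below level `k` lie on the small-field guard of (0.4), then so do those of `U·exp X` for every `X`
near `0` (induction on the level: on the guard the next iterate is the `C^∞` matrix extension, whose loop matrices move continuously, and the guard is a finite family of strict
inequalities). [cite: Balaban1987RG1, (0.4) p.253, (0.21) p.256] -/
theorem eventually_smallBelow_expChart {U : GaugeField P 0 (SU N)} :
    ∀ {k : ℕ}, SmallBelow (fun j => blockAvg (P := P) (j := j) expMeanLogSU) k U →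
      ∀ᶠ X in 𝓝 (0 : PBond P 0 → lieSU (Fin N)), SmallBelow (fun j => blockAvg (P := P) (j := j) expMeanLogSU) k (expChart U X)
  | 0, _ => Eventually.of_forall fun X j hj => (Nat.not_lt_zero j hj).elim
  | k + 1, h => by
    have hk : SmallBelow (fun j => blockAvg (P := P) (j := j) expMeanLogSU) k U := h.mono (Nat.le_succ k)
    have ih := eventually_smallBelow_expChart hk
    -- the smooth model of `Ū^k(U·exp X)` and its loop matrices
    have hG : ContinuousAt (fun X : PBond P 0 → lieSU (Fin N) => iterM k (coeField (expChart U X))) 0 :=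
      (contDiffAt_iterM_expChart hk).continuousAt
    have hG0 : iterM k (coeField (expChart U (0 : PBond P 0 → lieSU (Fin N)))) =
        coeField (Averaging.iter (fun j => blockAvg (P := P) (j := j) expMeanLogSU) k U) := by
      rw [expChart_zero, coeField_iter_eq_iterM k hk]
    have hloop : ∀ ci : PBond P (k + 1) × Idx P, ∀ᶠ X in 𝓝 (0 : PBond P 0 → lieSU (Fin N)),
        ‖loopM (iterM k (coeField (expChart U X))) ci.1 ci.2 - 1‖ < deltaSU (Fin N) := by
      intro ci
      have hf : ContinuousAt (fun X : PBond P 0 → lieSU (Fin N) => ‖loopM (iterM k (coeField (expChart U X))) ci.1 ci.2 - 1‖) 0 :=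
        (((contDiff_loopM ci.1 ci.2).continuous.continuousAt.comp hG).sub continuousAt_const).norm
      have h0 : ‖loopM (iterM k (coeField (expChart U (0 : PBond P 0 → lieSU (Fin N))))) ci.1 ci.2 - 1‖ < deltaSU (Fin N) := by
        rw [hG0]
        exact norm_loopM_coeField_sub_one_lt _ ci.1 (h k (Nat.lt_succ_self k) ci.1) ci.2
      exact hf.tendsto.eventually_lt_const h0
    refine (ih.and (eventually_all.2 hloop)).mono fun X hX => smallBelow_succ_iff.2 ⟨hX.1, fun c i => ?_⟩
    have hle : ‖loopM (coeField (Averaging.iter (fun j => blockAvg (P := P) (j := j) expMeanLogSU) k (expChart U X))) c i - 1‖ < deltaSU (Fin N) := by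
      rw [coeField_iter_eq_iterM k hX.1]
      exact hX.2 (c, i)
    rw [← coe_loopHol] at hle
    exact hle

end Guard

section Chart

variable (F : T4Family) (N : ℕ) [NeZero N]

/-- **The CONSTRAINED BONDS of levels `≤ k` of a determining set `𝐁`**: pairs `(j, c)` with `j ≤ k` and `c` a `j`-bond MEETING `Γ_j` (`B15DeterminingSets.bondsOf`, the
reading of `AgreeOn`).  A finite type (finitely many bonds per level). [cite: Balaban1988Convergent, (2.2) p.255, (2.10) p.256] -/
abbrev ConstrSet {P : Params} (𝔹 : DetSet P) (k : ℕ) : Type := Σ j : Fin (k + 1), {c : PBond P j // c ∈ bondsOf (𝔹 j)}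

/-- The number of constrained bonds of levels `≤ k`. [cite: Balaban1988Convergent, (2.2) p.255 (bookkeeping)] -/
def constrCard {P : Params} (𝔹 : DetSet P) (k : ℕ) : ℕ := Nat.card (ConstrSet 𝔹 k)

/-- An enumeration of the constrained bonds of levels `≤ k` (the target of the chart is `𝔰𝔲(N)^{#constraints}`). [cite: Balaban1988Convergent, (2.2) p.255 (bookkeeping)] -/
def constrEnum {P : Params} (𝔹 : DetSet P) (k : ℕ) : ConstrSet 𝔹 k ≃ Fin (constrCard 𝔹 k) := Finite.equivFin _

variable {F N} in
/-- The RELATIVE average `W_j(c)* · Ū^j(V)(c)` of a configuration `V` against the multi-scale datum `W` at a `j`-bond `c` (an `SU(N)` matrix; `= 1` iff `Ū^j(V)(c) = W_j(c)`).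
[cite: Balaban1988Convergent, (2.10)–(2.11) p.256] -/
def relAvg (K : ℕ) (W : MSField (F.P K) (SU N)) (V : GaugeField (F.P K) 0 (SU N)) (j : ℕ) (c : PBond (F.P K) j) : Matrix (Fin N) (Fin N) ℂ :=
  star ((W j c : SU N) : Matrix (Fin N) (Fin N) ℂ) * ((avgFamily (avOfRecord F N K) V j c : SU N) : Matrix (Fin N) (Fin N) ℂ)

/-- ★ **THE CANONICAL LOGARITHMIC CHART OF THE MULTI-SCALE CONSTRAINT `Ū^j = W_j` ON `𝐁` AT `U`**: `Φ(X) = (π(log(W_j(c)* · Ū^j(U·exp X)(c))))_{(j,c)}`, indexed by the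
enumerated constrained bonds of levels `≤ k`, with values in `𝔰𝔲(N)` (`π = suProj`, the identity on `𝔰𝔲(N)` where `log` of an `SU(N)` matrix near `1` lands).  This is the chart
35a (`IsFibreChartNear`) asks for; print's rôle for it is the LINEARIZING TRANSFORMATION of Sect. C. [cite: Balaban1985Variational, Sect. C (47)–(48) p.285, (82)–(83) p.290; Balaban1988Convergent, (2.10)–(2.12) p.256] -/
def msChart (K k : ℕ) (𝔹 : DetSet (F.P K)) (W : MSField (F.P K) (SU N)) (U : GaugeField (F.P K) 0 (SU N))
    (X : PBond (F.P K) 0 → lieSU (Fin N)) : Fin (constrCard 𝔹 k) → lieSU (Fin N) := fun i =>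
  suProj N (mlog (relAvg K W (expChart U X) ((constrEnum 𝔹 k).symm i).1 ((constrEnum 𝔹 k).symm i).2.1))

variable {F N}
variable {K k : ℕ} {𝔹 : DetSet (F.P K)} {W : MSField (F.P K) (SU N)} {U : GaugeField (F.P K) 0 (SU N)}

/-- Unfolding the chart at an index. [cite: Balaban1985Variational, (82)–(83) p.290 (bookkeeping)] -/
theorem msChart_apply (X : PBond (F.P K) 0 → lieSU (Fin N)) (i : Fin (constrCard 𝔹 k)) :
    msChart F N K k 𝔹 W U X i = suProj N (mlog (relAvg K W (expChart U X) ((constrEnum 𝔹 k).symm i).1 ((constrEnum 𝔹 k).symm i).2.1)) := rfl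

/-- On the fibre the relative averages at constrained bonds are `1`. [cite: Balaban1988Convergent, (2.10) p.256] -/
theorem relAvg_eq_one_of_agreeOn {V : GaugeField (F.P K) 0 (SU N)} (hV : AgreeOn 𝔹 (avgFamily (avOfRecord F N K) V) W) {j : ℕ} {c : PBond (F.P K) j}
    (hc : c ∈ bondsOf (𝔹 j)) : relAvg K W V j c = 1 := by
  rw [relAvg, hV j c hc, star_coe_mul_coe_SU]

/-- The relative average is an `SU(N)` matrix. [cite: Balaban1988Convergent, (2.10)–(2.11) p.256 (bookkeeping)] -/
theorem relAvg_mem_SU (V : GaugeField (F.P K) 0 (SU N)) (j : ℕ) (c : PBond (F.P K) j) : relAvg K W V j c ∈ Matrix.specialUnitaryGroup (Fin N) ℂ :=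
  star_coe_mul_coe_mem_SU _ _

/-- `relAvg = 1 ⇒ Ū^j(V)(c) = W_j(c)`. [cite: Balaban1988Convergent, (2.10) p.256] -/
theorem avg_eq_of_relAvg_eq_one {V : GaugeField (F.P K) 0 (SU N)} {j : ℕ} {c : PBond (F.P K) j} (h : relAvg K W V j c = 1) :
    avgFamily (avOfRecord F N K) V j c = W j c := by
  apply Subtype.ext
  have h' := congrArg (fun M => ((W j c : SU N) : Matrix (Fin N) (Fin N) ℂ) * M) h
  simp only [relAvg, ← mul_assoc, coe_mul_star_coe_SU, one_mul, mul_one] at h'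
  exact h'

/-- **The chart is centred on the fibre**: `Φ(0) = 0` when `U` lies in the fibre `𝔅(𝐁, W)`. [cite: Balaban1985Variational, (3) p.278; Balaban1988Convergent, (2.10) p.256] -/
theorem msChart_zero_of_agreeOn (hU : AgreeOn 𝔹 (avgFamily (avOfRecord F N K) U) W) : msChart F N K k 𝔹 W U 0 = 0 := by
  funext i
  rw [msChart_apply, expChart_zero, relAvg_eq_one_of_agreeOn hU ((constrEnum 𝔹 k).symm i).2.2, mlog_one, map_zero]
  rfl

/-! ## §4  Strict differentiability of the chart at `0` (35b-i: the averaging is `C^∞` on the guard; `log` is analytic near `1`) and the derivative in velocity currency -/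

/-- The smooth model of one component of the chart on the guard: `X ↦ W* · (iterM j ↑(U·exp X))(c)`. [cite: Balaban1987RG1, (0.4) p.253 («analytic function»)] -/
theorem contDiffAt_star_mul_iterM_expChart (hsb : SmallBelow (avOfRecord F N K) k U) {j : ℕ} (hj : j ≤ k) (c : PBond (F.P K) j) (Wm : Matrix (Fin N) (Fin N) ℂ) :
    ContDiffAt ℝ ⊤ (fun X : PBond (F.P K) 0 → lieSU (Fin N) => Wm * iterM j (coeField (expChart U X)) c) 0 := by
  have h1 : ContDiffAt ℝ ⊤ (fun X : PBond (F.P K) 0 → lieSU (Fin N) => iterM j (coeField (expChart U X))) 0 :=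
    contDiffAt_iterM_expChart (P := F.P K) (hsb.mono hj)
  have h2 : ContDiffAt ℝ ⊤ (fun X : PBond (F.P K) 0 → lieSU (Fin N) => iterM j (coeField (expChart U X)) c) 0 := (contDiffAt_pi.1 h1) c
  exact contDiffAt_const.mul h2

/-- On the guard the relative average IS the smooth model. [cite: Balaban1987RG1, (0.4) p.253, (0.21) p.256] -/
theorem relAvg_expChart_eq_of_smallBelow {X : PBond (F.P K) 0 → lieSU (Fin N)} (hX : SmallBelow (avOfRecord F N K) k (expChart U X)) {j : ℕ} (hj : j ≤ k)
    (c : PBond (F.P K) j) :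
    relAvg K W (expChart U X) j c = star ((W j c : SU N) : Matrix (Fin N) (Fin N) ℂ) * iterM j (coeField (expChart U X)) c := by
  rw [relAvg, ← coeField_avgFamily_eq_iterM (hX.mono hj)]
  rfl

/-- ★ **THE CHART IS `C^∞` AT `0`** when `U` lies in the fibre and the iterated averages of `U·exp X` stay on the small-field guard for `X` near `0` (then each component is
`π ∘ log ∘ (W* · iterM j ↑(U·exp X))(c))` near `0`, with `log` analytic at `W*W = 1`). [cite: Balaban1987RG1, (0.4) p.253; Balaban1985Averaging, (21) p.21; Balaban1985Variational, Sect. C p.285] -/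
theorem contDiffAt_msChart (hU : AgreeOn 𝔹 (avgFamily (avOfRecord F N K) U) W)
    (hsb : SmallBelow (avOfRecord F N K) k U) :
    ContDiffAt ℝ ⊤ (msChart F N K k 𝔹 W U) 0 := by
  have hsb0 := hsb
  have hsbN : ∀ᶠ X in 𝓝 (0 : PBond (F.P K) 0 → lieSU (Fin N)), SmallBelow (avOfRecord F N K) k (expChart U X) :=
    eventually_smallBelow_expChart (P := F.P K) hsb
  refine contDiffAt_pi.2 fun i => ?_
  set s := (constrEnum 𝔹 k).symm i with hs
  have hj : (s.1 : ℕ) ≤ k := Nat.lt_succ_iff.1 s.1.2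
  -- the smooth model of component `i`
  have hmodel : ContDiffAt ℝ ⊤ (fun X : PBond (F.P K) 0 → lieSU (Fin N) =>
      suProj N (mlog (star ((W s.1 s.2.1 : SU N) : Matrix (Fin N) (Fin N) ℂ) * iterM s.1 (coeField (expChart U X)) s.2.1))) 0 := by
    have hin := contDiffAt_star_mul_iterM_expChart hsb0 hj s.2.1 (star ((W s.1 s.2.1 : SU N) : Matrix (Fin N) (Fin N) ℂ))
    have h0 : star ((W s.1 s.2.1 : SU N) : Matrix (Fin N) (Fin N) ℂ) * iterM s.1 (coeField (expChart U 0)) s.2.1 = 1 := by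
      rw [← relAvg_expChart_eq_of_smallBelow (by rw [expChart_zero]; exact hsb0) hj, expChart_zero]
      exact relAvg_eq_one_of_agreeOn hU s.2.2
    have hlog : ContDiffAt ℝ ⊤ (mlog : Matrix (Fin N) (Fin N) ℂ → Matrix (Fin N) (Fin N) ℂ)
        (star ((W s.1 s.2.1 : SU N) : Matrix (Fin N) (Fin N) ℂ) * iterM s.1 (coeField (expChart U 0)) s.2.1) := by
      rw [h0]
      exact ((analyticAt_mlog (by simp)).contDiffAt).restrict_scalars ℝ
    have hcomp : ContDiffAt ℝ ⊤ (fun X : PBond (F.P K) 0 → lieSU (Fin N) =>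
        mlog (star ((W s.1 s.2.1 : SU N) : Matrix (Fin N) (Fin N) ℂ) * iterM s.1 (coeField (expChart U X)) s.2.1)) 0 :=
      ContDiffAt.comp (g := (mlog : Matrix (Fin N) (Fin N) ℂ → Matrix (Fin N) (Fin N) ℂ))
        (f := fun X : PBond (F.P K) 0 → lieSU (Fin N) => star ((W s.1 s.2.1 : SU N) : Matrix (Fin N) (Fin N) ℂ) * iterM s.1 (coeField (expChart U X)) s.2.1)
        0 hlog hin
    exact (suProj N).contDiff.contDiffAt.comp 0 hcomp
  refine hmodel.congr_of_eventuallyEq (hsbN.mono fun X hX => ?_)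
  show msChart F N K k 𝔹 W U X i = _
  rw [msChart_apply, ← hs, relAvg_expChart_eq_of_smallBelow hX hj]

/-- ★ **HENCE STRICTLY DIFFERENTIABLE AT `0`**, with derivative `Φ′ := fderiv Φ 0` — the first clause of `IsFibreChartNear`. [cite: Balaban1985Variational, (82)–(83) p.290] -/
theorem hasStrictFDerivAt_msChart (hU : AgreeOn 𝔹 (avgFamily (avOfRecord F N K) U) W)
    (hsb : SmallBelow (avOfRecord F N K) k U) :
    HasStrictFDerivAt (msChart F N K k 𝔹 W U) (fderiv ℝ (msChart F N K k 𝔹 W U) 0) 0 :=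
  (contDiffAt_msChart hU hsb).hasStrictFDerivAt (by simp)

/-- ★★ **THE DERIVATIVE OF THE CHART IN VELOCITY CURRENCY** (the linearised constraint, read through `log` at `1`): if the matrix of `Ū^j(U·exp(tX))(c)` has velocity `v`
at `t = 0` at the constrained bond `(j, c)` enumerated `i`, then `(Φ′X)_i = π(W_j(c)* · v)` — `D log(1) = id` (`B7TransferAnalyticMean.hasFDerivAt_mlog_one`).
[cite: Balaban1985Variational, Sect. C (44)–(48) p.285 (the linearised averaging), (83) p.290] -/
theorem fderiv_msChart_apply_of_hasDerivAt (hU : AgreeOn 𝔹 (avgFamily (avOfRecord F N K) U) W)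
    (hsb : SmallBelow (avOfRecord F N K) k U)
    (X : PBond (F.P K) 0 → lieSU (Fin N)) (i : Fin (constrCard 𝔹 k)) {v : Matrix (Fin N) (Fin N) ℂ}
    (hv : HasDerivAt (fun t : ℝ => ((avgFamily (avOfRecord F N K) (expChart U (t • X)) ((constrEnum 𝔹 k).symm i).1 ((constrEnum 𝔹 k).symm i).2.1 : SU N) :
      Matrix (Fin N) (Fin N) ℂ)) v 0) :
    fderiv ℝ (msChart F N K k 𝔹 W U) 0 X i = suProj N (star ((W ((constrEnum 𝔹 k).symm i).1 ((constrEnum 𝔹 k).symm i).2.1 : SU N) : Matrix (Fin N) (Fin N) ℂ) * v) := by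
  set s := (constrEnum 𝔹 k).symm i with hs
  set Ws : Matrix (Fin N) (Fin N) ℂ := star ((W s.1 s.2.1 : SU N) : Matrix (Fin N) (Fin N) ℂ) with hWs
  -- the chart along the ray has derivative `Φ′X`
  have hray : HasDerivAt (fun t : ℝ => msChart F N K k 𝔹 W U (t • X)) (fderiv ℝ (msChart F N K k 𝔹 W U) 0 X) 0 := by
    have h := (hasStrictFDerivAt_msChart hU hsb).hasFDerivAt.comp_hasDerivAt_of_eq (0 : ℝ) (hasDerivAt_ray X) (zero_smul ℝ X).symm
    exact h
  have hrayi : HasDerivAt (fun t : ℝ => msChart F N K k 𝔹 W U (t • X) i) (fderiv ℝ (msChart F N K k 𝔹 W U) 0 X i) 0 := (hasDerivAt_pi.1 hray) i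
  -- direct computation of the component along the ray
  have hg : HasDerivAt (fun t : ℝ => Ws * ((avgFamily (avOfRecord F N K) (expChart U (t • X)) s.1 s.2.1 : SU N) : Matrix (Fin N) (Fin N) ℂ)) (Ws * v) 0 :=
    hv.const_mul Ws
  have hg0 : Ws * ((avgFamily (avOfRecord F N K) (expChart U ((0 : ℝ) • X)) s.1 s.2.1 : SU N) : Matrix (Fin N) (Fin N) ℂ) = 1 := by
    rw [zero_smul, expChart_zero]
    exact relAvg_eq_one_of_agreeOn hU s.2.2
  have hlog : HasDerivAt (fun t : ℝ => mlog (Ws * ((avgFamily (avOfRecord F N K) (expChart U (t • X)) s.1 s.2.1 : SU N) : Matrix (Fin N) (Fin N) ℂ))) (Ws * v) 0 := by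
    have hD : HasFDerivAt (mlog : Matrix (Fin N) (Fin N) ℂ → Matrix (Fin N) (Fin N) ℂ)
        (((1 : Matrix (Fin N) (Fin N) ℂ →L[ℂ] Matrix (Fin N) (Fin N) ℂ)).restrictScalars ℝ)
        (Ws * ((avgFamily (avOfRecord F N K) (expChart U ((0 : ℝ) • X)) s.1 s.2.1 : SU N) : Matrix (Fin N) (Fin N) ℂ)) := by
      rw [hg0]
      exact (B7TransferAnalyticMean.hasFDerivAt_mlog_one).restrictScalars ℝ
    have h := hD.comp_hasDerivAt (0 : ℝ) hg
    rw [ContinuousLinearMap.coe_restrictScalars', one_apply_eq_self] at h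
    exact h
  have hdirect : HasDerivAt (fun t : ℝ => msChart F N K k 𝔹 W U (t • X) i) (suProj N (Ws * v)) 0 := by
    have h := (suProj N).hasFDerivAt.comp_hasDerivAt (0 : ℝ) hlog
    exact h
  exact hrayi.unique hdirect

/-! ## §5  The level set of the chart through `0` lies in the fibre (near `0`) -/

/-- Near `0` every relative average at a constrained bond of level `≤ k` is `ρ_N`-close to `1` (continuity of the smooth model at `0`, where it equals `1`).
[cite: Balaban1987RG1, (0.4) p.253; Balaban1988Convergent, (2.10) p.256] -/
theorem eventually_norm_relAvg_sub_one_le (hU : AgreeOn 𝔹 (avgFamily (avOfRecord F N K) U) W)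
    (hsb : SmallBelow (avOfRecord F N K) k U) :
    ∀ᶠ X in 𝓝 (0 : PBond (F.P K) 0 → lieSU (Fin N)), ∀ i : Fin (constrCard 𝔹 k),
      ‖relAvg K W (expChart U X) ((constrEnum 𝔹 k).symm i).1 ((constrEnum 𝔹 k).symm i).2.1 - 1‖ ≤ rhoSU N := by
  have hsb0 := hsb
  have hsbN : ∀ᶠ X in 𝓝 (0 : PBond (F.P K) 0 → lieSU (Fin N)), SmallBelow (avOfRecord F N K) k (expChart U X) :=
    eventually_smallBelow_expChart (P := F.P K) hsb
  refine eventually_all.2 fun i => ?_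
  set s := (constrEnum 𝔹 k).symm i with hs
  have hj : (s.1 : ℕ) ≤ k := Nat.lt_succ_iff.1 s.1.2
  set gM : (PBond (F.P K) 0 → lieSU (Fin N)) → Matrix (Fin N) (Fin N) ℂ :=
    fun X => star ((W s.1 s.2.1 : SU N) : Matrix (Fin N) (Fin N) ℂ) * iterM s.1 (coeField (expChart U X)) s.2.1 with hgM
  have hcont : ContinuousAt gM 0 := (contDiffAt_star_mul_iterM_expChart hsb0 hj s.2.1 _).continuousAt
  have h0 : gM 0 = 1 := by
    rw [hgM]
    show star ((W s.1 s.2.1 : SU N) : Matrix (Fin N) (Fin N) ℂ) * iterM s.1 (coeField (expChart U 0)) s.2.1 = 1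
    rw [← relAvg_expChart_eq_of_smallBelow (by rw [expChart_zero]; exact hsb0) hj, expChart_zero]
    exact relAvg_eq_one_of_agreeOn hU s.2.2
  have hnear : ∀ᶠ X in 𝓝 (0 : PBond (F.P K) 0 → lieSU (Fin N)), ‖gM X - 1‖ ≤ rhoSU N := by
    have ht : Tendsto gM (𝓝 0) (𝓝 1) := by rw [← h0]; exact hcont.tendsto
    have hball := (Metric.tendsto_nhds.1 ht) (rhoSU N) rhoSU_pos
    exact hball.mono fun X hX => by rw [dist_eq_norm] at hX; exact hX.le
  exact (hnear.and hsbN).mono fun X hX => by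
    rw [relAvg_expChart_eq_of_smallBelow hX.2 hj]
    exact hX.1

/-- ★ **THE LEVEL SET OF THE CHART THROUGH `0` LIES IN THE FIBRE, NEAR `0`** (the third clause of `IsFibreChartNear`): for `X` near `0`, `Φ(X) = Φ(0)` forces `Ū^j(U·exp X) = W_j` on
every bond meeting `Γ_j`, `j ≤ k` (§2: `π(log g) = 0 ⇒ g = 1` for `g ∈ SU(N)` `ρ_N`-close to `1`), and the members above `k` are empty. [cite: Balaban1985Variational, (3) p.278, (82)–(83) p.290; Balaban1988Convergent, (2.10) p.256] -/
theorem eventually_agreeOn_of_msChart_eq (h𝔹 : ∀ j, k < j → 𝔹 j = ∅) (hU : AgreeOn 𝔹 (avgFamily (avOfRecord F N K) U) W)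
    (hsb : SmallBelow (avOfRecord F N K) k U) :
    ∀ᶠ X in 𝓝 (0 : PBond (F.P K) 0 → lieSU (Fin N)),
      msChart F N K k 𝔹 W U X = msChart F N K k 𝔹 W U 0 → AgreeOn 𝔹 (avgFamily (avOfRecord F N K) (expChart U X)) W := by
  refine (eventually_norm_relAvg_sub_one_le hU hsb).mono fun X hX hΦ j c hc => ?_
  by_cases hj : j ≤ k
  · set s : ConstrSet 𝔹 k := ⟨⟨j, Nat.lt_succ_of_le hj⟩, c, hc⟩ with hs
    have hi := congrFun hΦ (constrEnum 𝔹 k s)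
    rw [msChart_zero_of_agreeOn hU] at hi
    rw [msChart_apply, Equiv.symm_apply_apply] at hi
    have hρ := hX (constrEnum 𝔹 k s)
    rw [Equiv.symm_apply_apply] at hρ
    exact avg_eq_of_relAvg_eq_one (eq_one_of_suProj_mlog_eq_zero (relAvg_mem_SU _ _ _) hρ hi)
  · exfalso
    have he : 𝔹 j = ∅ := h𝔹 j (lt_of_not_ge hj)
    rw [he] at hc
    simp [bondsOf] at hc

/-! ## §6  `IsFibreChartNear` from a right inverse of the linearised constraint ((45) at `U`, velocity currency), and the tangent form on the multi-scale fibre -/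

/-- ★★ **35a's `IsFibreChartNear` FOR THE MULTI-SCALE FIBRE `𝔅(𝐁, W)`, FROM [15] (45) AT `U`.**  Hypotheses: `𝐁` has no member above `k`; `U` lies in the fibre; the iterated averages of
`U·exp X` stay on the small-field guard for `X` near `0`; and (45) AT `U` IN VELOCITY CURRENCY — every family of tangent targets `W_j(c)·τ_j(c)`, `τ_j(c) ∈ 𝔰𝔲(N)`, on the constrained bonds of
levels `≤ k` is the velocity family at `t = 0` of `t ↦ Ū^j(U·exp(tX))(c)` for some direction `X` (i.e. the linearised multi-scale constraint at `U` has a right inverse — print's `H` with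
`L^jηQ_jHB = B on Λ_j` (45), here only its EXISTENCE).  Then the canonical chart `Φ` is a submersive chart of the constraint near `U`.
[cite: Balaban1985Variational, (45)–(48) p.285, Prop. 3 p.289, (82)–(83) p.290; Balaban1988Convergent, (2.10)–(2.12) p.256] -/
theorem isFibreChartNear_msChart (h𝔹 : ∀ j, k < j → 𝔹 j = ∅) (hU : AgreeOn 𝔹 (avgFamily (avOfRecord F N K) U) W)
    (hsb : SmallBelow (avOfRecord F N K) k U)
    (hH : ∀ τ : (j : ℕ) → PBond (F.P K) j → lieSU (Fin N), ∃ X : PBond (F.P K) 0 → lieSU (Fin N), ∀ j, j ≤ k → ∀ c ∈ bondsOf (𝔹 j),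
      HasDerivAt (fun t : ℝ => ((avgFamily (avOfRecord F N K) (expChart U (t • X)) j c : SU N) : Matrix (Fin N) (Fin N) ℂ))
        (((W j c : SU N) : Matrix (Fin N) (Fin N) ℂ) * ((τ j c : lieSU (Fin N)) : Matrix (Fin N) (Fin N) ℂ)) 0) :
    IsFibreChartNear F N K 𝔹 W U (msChart F N K k 𝔹 W U) (fderiv ℝ (msChart F N K k 𝔹 W U) 0) := by
  classical
  refine ⟨hasStrictFDerivAt_msChart hU hsb, ?_, eventually_agreeOn_of_msChart_eq h𝔹 hU hsb⟩
  -- the derivative is onto: realise any `τ′ : Fin m → 𝔰𝔲(N)` as `Φ′X`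
  refine LinearMap.range_eq_top.2 fun τ' => ?_
  let τ : (j : ℕ) → PBond (F.P K) j → lieSU (Fin N) := fun j c =>
    if h : j < k + 1 ∧ c ∈ bondsOf (𝔹 j) then τ' (constrEnum 𝔹 k ⟨⟨j, h.1⟩, c, h.2⟩) else 0
  obtain ⟨X, hX⟩ := hH τ
  refine ⟨X, funext fun i => ?_⟩
  set s := (constrEnum 𝔹 k).symm i with hs
  have hj : (s.1 : ℕ) ≤ k := Nat.lt_succ_iff.1 s.1.2
  have hv := hX s.1 hj s.2.1 s.2.2
  have hτ : τ s.1 s.2.1 = τ' i := by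
    show (if h : (s.1 : ℕ) < k + 1 ∧ (s.2.1 : PBond (F.P K) s.1) ∈ bondsOf (𝔹 s.1) then τ' (constrEnum 𝔹 k ⟨⟨s.1, h.1⟩, s.2.1, h.2⟩) else 0) = τ' i
    rw [dif_pos ⟨s.1.2, s.2.2⟩]
    show τ' (constrEnum 𝔹 k s) = τ' i
    rw [hs, Equiv.apply_symm_apply]
  show fderiv ℝ (msChart F N K k 𝔹 W U) 0 X i = τ' i
  rw [fderiv_msChart_apply_of_hasDerivAt hU hsb X i hv, ← mul_assoc, star_coe_mul_coe_SU, one_mul, hτ, suProj_coe]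

/-- ★★★ **CURVE-CRITICAL ⇒ TANGENT-CRITICAL ON A MULTI-SCALE FIBRE, MODULO [15] (45) AT `U`.**  For a determining set `𝐁` with no member above `k`, a configuration `U` in the fibre
`𝔅(𝐁, W)` whose chart neighbours stay on the small-field guard, and a right inverse (velocity currency) of the linearised multi-scale constraint at `U`: if `U` is a critical configuration of
the Wilson action (5) on the fibre in the CURVE form (`IsCritOnFibre`), then `d∕dt A(U·exp(tX))∣_{t=0} = 0` for EVERY kernel direction `X` of the linearised constraint — print's (82) on the
tangent space (83), for the multi-scale fibre of [III] (2.10)–(2.12) (stub 1's `genSet s.Ω k` included).  Proof: §6's chart + 35a `hasDerivAt_wilsonAction4_expChart_of_isCritOnFibre_near`.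
[cite: Balaban1985Variational, (82)–(83) p.290, (141) p.299, p.300, Prop. 8 p.304, Sect. C (45)–(48) p.285; Balaban1988Convergent, (2.10)–(2.12) p.256] -/
theorem hasDerivAt_wilsonAction4_expChart_of_isCritOnFibre_of_rightInverse (h𝔹 : ∀ j, k < j → 𝔹 j = ∅)
    (hU : AgreeOn 𝔹 (avgFamily (avOfRecord F N K) U) W)
    (hsb : SmallBelow (avOfRecord F N K) k U)
    (hH : ∀ τ : (j : ℕ) → PBond (F.P K) j → lieSU (Fin N), ∃ X : PBond (F.P K) 0 → lieSU (Fin N), ∀ j, j ≤ k → ∀ c ∈ bondsOf (𝔹 j),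
      HasDerivAt (fun t : ℝ => ((avgFamily (avOfRecord F N K) (expChart U (t • X)) j c : SU N) : Matrix (Fin N) (Fin N) ℂ))
        (((W j c : SU N) : Matrix (Fin N) (Fin N) ℂ) * ((τ j c : lieSU (Fin N)) : Matrix (Fin N) (Fin N) ℂ)) 0)
    (hcrit : IsCritOnFibre F N K 𝔹 W U) {X : PBond (F.P K) 0 → lieSU (Fin N)}
    (hX : ∀ j, j ≤ k → ∀ c ∈ bondsOf (𝔹 j),
      HasDerivAt (fun t : ℝ => ((avgFamily (avOfRecord F N K) (expChart U (t • X)) j c : SU N) : Matrix (Fin N) (Fin N) ℂ)) 0 0) :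
    HasDerivAt (fun t : ℝ => wilsonAction4 (expChart U (t • X))) 0 0 := by
  refine hasDerivAt_wilsonAction4_expChart_of_isCritOnFibre_near (isFibreChartNear_msChart h𝔹 hU hsb hH) hcrit ?_
  funext i
  set s := (constrEnum 𝔹 k).symm i with hs
  have hv := hX s.1 (Nat.lt_succ_iff.1 s.1.2) s.2.1 s.2.2
  have h := fderiv_msChart_apply_of_hasDerivAt hU hsb X i hv
  rw [mul_zero, map_zero] at h
  exact h

/-- The K0 reading: the same on stub 1's multi-scale fibre `𝔅(genSet Ω k, W)` of [III] (2.2) (`Γ_j = ∅` above `k` by `gammaRegion`).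
[cite: Balaban1988Convergent, (2.2) p.255, (2.10)–(2.12) p.256; Balaban1985Variational, Prop. 8 p.304] -/
theorem hasDerivAt_wilsonAction4_expChart_of_isCritOnFibre_genSet_of_rightInverse {Ω : ℕ → Set (Site (F.P K) 0)}
    (hU : AgreeOn (genSet Ω k) (avgFamily (avOfRecord F N K) U) W)
    (hsb : SmallBelow (avOfRecord F N K) k U)
    (hH : ∀ τ : (j : ℕ) → PBond (F.P K) j → lieSU (Fin N), ∃ X : PBond (F.P K) 0 → lieSU (Fin N), ∀ j, j ≤ k → ∀ c ∈ bondsOf (genSet Ω k j),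
      HasDerivAt (fun t : ℝ => ((avgFamily (avOfRecord F N K) (expChart U (t • X)) j c : SU N) : Matrix (Fin N) (Fin N) ℂ))
        (((W j c : SU N) : Matrix (Fin N) (Fin N) ℂ) * ((τ j c : lieSU (Fin N)) : Matrix (Fin N) (Fin N) ℂ)) 0)
    (hcrit : IsCritOnFibre F N K (genSet Ω k) W U) {X : PBond (F.P K) 0 → lieSU (Fin N)}
    (hX : ∀ j, j ≤ k → ∀ c ∈ bondsOf (genSet Ω k j),
      HasDerivAt (fun t : ℝ => ((avgFamily (avOfRecord F N K) (expChart U (t • X)) j c : SU N) : Matrix (Fin N) (Fin N) ℂ)) 0 0) :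
    HasDerivAt (fun t : ℝ => wilsonAction4 (expChart U (t • X))) 0 0 := by
  have hgen : ∀ j, k < j → genSet Ω k j = (∅ : Set (Site (F.P K) j)) := fun j hj => by
    ext y; simp [genSet, gammaRegion, hj]
  exact hasDerivAt_wilsonAction4_expChart_of_isCritOnFibre_of_rightInverse hgen hU hsb hH hcrit hX

end Chart

end Literature.MathematicalPhysics.QuantumFieldTheory.Balaban1983to89.Node00

end
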